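import Literature.Computability.Complexity.IrreducibilityLLLGcdFP
import Literature.Computability.Complexity.IrreducibilityLLLPrimeSearch
import Literature.Computability.Complexity.CodeFPBudgets
import Literature.Computability.Complexity.CodeFPFinite
import HarnessLib

/-!
# The search for the small prime runs in polynomial time (`CodeFP`)

Support file for the discharge of the named fact
`Literature.Computability.Complexity.lll_monicIrreducible_mem_P` (irreducibility of monic integer
polynomials is decidable in `P`; Lenstra–Lenstra–Lovász 1982, §3). Machine side of
`IrreducibilityLLLPrimeSearch.lean` (LLL82 (3.3), proof of (3.6)): the candidates `p ≤ primeRange f`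
are produced IN UNARY (the range bound `64 t² + 1`, `t` the bit length of `resBound f`, is built from
`t` in unary by unit arithmetic), so that trial division and the gcd test modulo `p⁺ = max p 2`
(`pgcdC`) apply to each candidate:

* `pderivC`, `isPrimeTDC`, `sqNormListC`, `resBoundC`, `primeRangeSuccU` (`f ↦ 1^{primeRange f + 1}`),
  `urangeUn` (`1ⁿ ↦ [1⁰, …, 1ⁿ⁻¹]`);
* `goodPrimeTestC`, **`goodPrimeC`**: `f ↦ goodPrime f` (the prime in unary).

## References

* S. Arora, B. Barak, *Computational Complexity: A Modern Approach*, CUP 2009, §1.3. [AroraBarak2009]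
* A. K. Lenstra, H. W. Lenstra Jr., L. Lovász, Math. Ann. 261 (1982), §3 (3.3), (3.6). [LenstraLenstraLovasz1982]
* J. von zur Gathen, J. Gerhard, *Modern Computer Algebra*, 3rd ed., CUP 2013, §15.6, §18.4. [GathenGerhard2013]
-/

noncomputable section

namespace Literature.Computability.Complexity

open Polynomial SumcheckMA CodeFP Brick _root_.Computability

namespace LLLFactoring

/-- The encoder of coefficient lists. -/
local notation "L" => rawE intE

/-! ### The ingredients of the test -/

/-- **`pderiv` on codes** (`mapIdx` then `tail`). [cite: AroraBarak2009, §1.3] -/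
theorem pderivC : CodeFP L L pderiv := by
  have hg : CodeFP (pairE unitE (pairE natE intE)) intE (fun t => (t.2.1 : ℤ) * t.2.2) :=
    (intMul.comp ((intOfNat.comp (snd _ _).fst').pair (snd _ _).snd') :)
  have hm : CodeFP (pairE unitE L) L (fun q => q.2.mapIdx fun i a => (i : ℤ) * a) := (mapIdx hg :)
  have h : CodeFP L L (fun l => (l.mapIdx fun i a => (i : ℤ) * a).tail) :=
    ((rawTail intE).comp (hm.comp ((const _ ()).pair (CodeFP.id _))) :)
  exact h.congr fun _ => rfl

/-- **Trial division on codes** (`p` unary: the divisors range over `[0, p)`). [cite: AroraBarak2009, §1.3] -/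
theorem isPrimeTDC : CodeFP unE bitE isPrimeTD := by
  have hpred : CodeFP (pairE unE natE) bitE (fun t => decide (t.2 < 2 ∨ t.1 % t.2 ≠ 0)) := by
    refine (((natLt.comp ((snd _ _).pair (const _ 2))).or
      (natEq.comp ((natMod.comp ((natOfUn.comp (fst _ _)).pair (snd _ _))).pair (const _ 0))).not).congr fun t => ?_)
    obtain ⟨p, d⟩ := t
    show (decide (d < 2) || !decide (id p % d = 0)) = decide (d < 2 ∨ p % d ≠ 0)
    by_cases h1 : d < 2 <;> by_cases h2 : p % d = 0 <;> simp [h1, h2]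
  have h : CodeFP unE bitE (fun p => decide (2 ≤ p) && (List.range p).all fun d => decide (d < 2 ∨ p % d ≠ 0)) :=
    ((unLeNat.comp ((const _ 2).pair natOfUn)).and ((all hpred).comp ((CodeFP.id _).pair urange)) :)
  exact h.congr fun _ => rfl

/-- `Σ cᵢ²` over `ℤ` is the cast of `sqNormList`. [folklore] -/
theorem sum_map_mul_self (a : List ℤ) : (a.map fun c => c * c).sum = (sqNormList a : ℤ) := by
  induction a with
  | nil => rfl
  | cons c a ih =>
    show c * c + (a.map fun c => c * c).sum = ((c.natAbs * c.natAbs + (a.map fun c => c.natAbs * c.natAbs).sum : ℕ) : ℤ)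
    rw [ih, Nat.cast_add, Int.natAbs_mul_self]
    rfl

/-- **`sqNormList` on codes.** [cite: AroraBarak2009, §1.3] -/
theorem sqNormListC : CodeFP L natE sqNormList :=
  (intToNat.comp (intSum.comp (map₀ (intMul.comp ((CodeFP.id _).pair (CodeFP.id _)))))).congr fun a => by
    show ((a.map fun c => id c * id c).sum).toNat = sqNormList a
    simp only [id]
    rw [sum_map_mul_self, Int.toNat_natCast]

/-- `|f| - 1` in unary. [folklore] -/
theorem predLengthU : CodeFP L unE (fun f => f.length - 1) :=
  ((unSubLen unitE).comp ((ulength intE).pair (const _ [()]))).congr fun _ => rfl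

/-- **`resBound` on codes.** [cite: AroraBarak2009, §1.3] -/
theorem resBoundC : CodeFP L natE resBound :=
  (natMul.comp ((natPow.comp ((natOfUn.comp predLengthU).pair predLengthU)).pair
    (natPow.comp (sqNormListC.pair predLengthU)))).congr fun _ => rfl

/-- **The range bound `primeRange f + 1` in unary**: `t = size (resBound f)` in unary, then `64 t² + 1`
by unit arithmetic. [cite: AroraBarak2009, §1.3] -/
theorem primeRangeSuccU : CodeFP L unE (fun f => primeRange f + 1) := by
  have ht : CodeFP L unE (fun f => Nat.size (resBound f)) :=
    Literature.Algebra.EuclideanLattices.Khot.unSize.comp resBoundC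
  have h64 : CodeFP L (rawE unitE) (fun f => List.replicate (64 * Nat.size (resBound f) ^ 2) ()) :=
    (unitsMul.comp ((const _ (List.replicate 64 ())).pair ((unitsPow 2).comp ht))).congr fun f => by
      simp
  exact (unSucc.comp ((ulength unitE).comp h64)).congr fun f => by simp [primeRange]

/-- **`1ⁿ ↦ [1⁰, …, 1ⁿ⁻¹]`**: the range with unary items (each binary item is converted under the
budget `n`). [cite: AroraBarak2009, §1.3] -/
theorem urangeUn : CodeFP unE (rawE unE) List.range :=
  ((map (σ := ℕ) (α := ℕ) (eσ := unE) (eα := natE) (eβ := unE) (g := fun t => min t.2 t.1) unOfNatMin).comp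
    ((CodeFP.id _).pair urange)).congr fun n => by
    show (List.range n).map (fun a => min a (id n)) = List.range n
    conv_rhs => rw [← List.map_id (List.range n)]
    exact List.map_congr_left fun a ha => by rw [List.mem_range] at ha; exact min_eq_left ha.le

/-! ### The test and the search -/

/-- **`goodPrimeTest f p` on codes** (`p` unary; the gcd is taken modulo `p⁺`, which only matters
when `p` is prime). [cite: LenstraLenstraLovasz1982, (3.6)] [cite: AroraBarak2009, §1.3] -/
theorem goodPrimeTestC : CodeFP (pairE L unE) bitE (fun t => goodPrimeTest t.1 t.2) := by
  have hp : CodeFP (pairE L unE) unE (fun t => t.2) := snd _ _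
  have hM : CodeFP (pairE L unE) natE (fun t => max t.2 2) := maxTwoUnC.comp hp
  have hf : CodeFP (pairE L unE) L (fun t => pnorm (max t.2 2) t.1) := (pnormC.comp (hM.pair (fst _ _)) :)
  have hf' : CodeFP (pairE L unE) L (fun t => pnorm (max t.2 2) (pderiv t.1)) :=
    (pnormC.comp (hM.pair (pderivC.comp (fst _ _))) :)
  have hg : CodeFP (pairE L unE) L (fun t => pgcd (max t.2 2) (pnorm (max t.2 2) t.1) (pnorm (max t.2 2) (pderiv t.1))) :=
    (pgcdC.comp (hp.pair (hf.pair hf')) :)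
  have heq : CodeFP (pairE L unE) bitE
      (fun t => decide (pgcd (max t.2 2) (pnorm (max t.2 2) t.1) (pnorm (max t.2 2) (pderiv t.1)) = [1])) :=
    ((eq (rawE_injective intE_injective)).comp (hg.pair (const _ [(1 : ℤ)])) :)
  refine (((isPrimeTDC.comp hp).and heq).congr fun t => ?_)
  obtain ⟨f, p⟩ := t
  show (isPrimeTD p && decide (pgcd (max p 2) (pnorm (max p 2) f) (pnorm (max p 2) (pderiv f)) = [1])) = goodPrimeTest f p
  rw [goodPrimeTest]
  by_cases h2 : 2 ≤ p
  · rw [max_eq_left h2]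
  · have : isPrimeTD p = false := by
      rw [← Bool.not_eq_true, isPrimeTD_iff]
      exact fun hp => h2 hp.two_le
    rw [this, Bool.false_and, Bool.false_and]

/-- **The prime of LLL82 (3.6) on codes**: `f ↦ goodPrime f`, the least candidate of the unary range
`[0, primeRange f]` passing the test (the prime is output in unary). [cite: LenstraLenstraLovasz1982, (3.6)] [cite: AroraBarak2009, §1.3] -/
theorem goodPrimeC : CodeFP L (optE unE) goodPrime :=
  ((rawFind? (σ := List ℤ) (α := ℕ) (eσ := L) (eα := unE) (p := fun t => goodPrimeTest t.1 t.2) goodPrimeTestC).comp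
    ((CodeFP.id _).pair (urangeUn.comp primeRangeSuccU))).congr fun _ => rfl

end LLLFactoring

end Literature.Computability.Complexity
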